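import Summits.BirchSwinnertonDyer.Rank1Residual.GaloisImage.PropagatedStructureKummerLevel
import Summits.BirchSwinnertonDyer.Rank1Residual.GaloisImage.LocalH1TorsionBounded
import Summits.BirchSwinnertonDyer.Rank1Residual.X11b.KummerRelaxedStructures
import Literature.NumberTheory.EllipticCurves.GoodReductionUnramifiedProofs
import HarnessLib

/-!
# `𝓕_can` on `E[p^{k+1}]` is UNRAMIFIED OUTSIDE `∞ ∪ {p} ∪ {bad}` — UNCONDITIONAL discharge of the
# binders `hunr`, `hS'` of the N11 Sakamoto instance (cell `b2b-bsdres`, team n1011, row T-a3-F1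
# (B4); seat n1011-p05 gen 2, PROPOSED ROW T-a3-F1-B4 under R3-25 (f))

HONEST FRAMING (cell `b2b-bsdres`, run/shared/lean/b2b/bsd-rank1-residual/, verbatim in every
file): the goal of the cell is to DELETE the COMBINATION-SHAPED residual classes of the
Birch–Swinnerton-Dyer formula for ALL analytic-rank `≤ 1` elliptic curves over `ℚ` — "full BSD
formula for every rank `≤ 1` curve in class `C`" assembled STRICTLY from published theorems — so
that the rank-`≤ 1` remainder becomes exactly the CONSTRUCTION-SHAPED classes, which are TYPED
(missing-input `Prop`s), NOT attempted. This is not "finishing BSD". Team n1011 (X4 ∧ `p = 3`,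
§I N11; row T-a3-F1 = the hypothesis side of Sakamoto 2024 Thm. 4.4 for `(E[3^{k+1}], 𝓕_can)`):
research route; theorems only; no definition, no named fact; nothing booked; no label changes.

## What and why

n1011-p13's N11 instance `kolyvaginSystems_freeRankOne_propagatedSelmerStructure`
(`GaloisImage/SakamotoN11Instance.lean`, p255331) takes, among its explicit binders, a finite set of
places `S` with `hS` (all archimedean places in `S`), `hS'` (every finite `v ∉ S` has `v ∤ 3` and
`E[3^{k+1}]` unramified at `v`) and
`hunr : (propagatedSelmerStructure W 3 k).IsUnramifiedOutside S` — Howard's Def. 2.1.10 for the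
canonical structure `𝓕_can(E[3^{k+1}])_v = im(H¹(ℚ_v, T₃E) → H¹(ℚ_v, E[3^{k+1}]))` propagated from
the Tate module (skel/T-a3-F1-N11.md §3, binder (B4): "binder until p06 lands (Lℓ)").  This file
discharges `hunr` and `hS'` for EVERY finite `S ⊇ ∞ ∪ {v ∣ p} ∪ {v : E has bad reduction at v}`,
generic prime `p` and level `k`, with NO binder left: the per-place local input hbd of n1011-p06's
(Lℓ) lemma (bounded exponent of `H¹(ℚ_v, E)[p^∞]`) is a THEOREM at every `v ∤ p` (sibling
`LocalH1TorsionBounded.lean`, from the tree's prime-to-`p` local Euler–Poincaré characteristic).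

* `kummerSelmerStructure_inr_eq_unramifiedSubgroup_pow_mul` — at a good finite `v ∤ p` the local
  Kummer condition of `E[p^{k+1}]` IS `H¹_ur(ℚ_v, E[p^{k+1}])`: the x11b (multr1) theorem
  `X11b.KummerPT.kummerSelmerStructure_inr_eq_unramifiedSubgroup` (Silverman X.4.4 / Milne I.3.8 at
  the completion, any number field) for `K = ℚ`, transported from the level spelling
  `((p ^ (k+1) : ℕ) : ℤ)` to p13's `(p : ℤ) ^ k * p` (IMPORTED BY NAME; nothing restated);
* `propagatedSelmerStructure_inr_eq_kummerSelmerStructure` — **`𝓕_can(E[p^{k+1}])_v = 𝓛_v(p^{k+1})`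
  at EVERY finite `v ∤ p`** (any reduction type), unconditional: the level-`k` sandwich of
  `PropagatedStructureKummerLevel.lean` fed with `bounded_pPrimaryTorsion_localGaloisModule_rat`;
* `propagatedSelmerStructure_inr_eq_unramifiedSubgroup` — **`𝓕_can(E[p^{k+1}])_v = H¹_ur(ℚ_v, E[p^{k+1}])`
  at every GOOD `v ∤ p`**, unconditional;
* `propagatedSelmerStructure_isUnramifiedOutside` — **`𝓕_can(E[p^{k+1}])` is `IsUnramifiedOutside S`**
  for every finite `S` containing the archimedean place, the place above `p` and the bad places
  = p13's `hunr`, NO further hypothesis;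
* `not_mem_and_isUnramifiedAt_of_not_mem` — for the same `S`, every finite `v ∉ S` has `v ∤ p` and
  `E[p^{k+1}]` unramified at `v` (Silverman VII.4.1(a), tree `smul_geomTorsion_eq_of_mem_inertia`)
  = p13's `hS'`;
* `exists_finset_isUnramifiedOutside` — such a finite `S` exists (x11b's `exists_exceptional_finset`:
  finitely many archimedean places, places above `p`, bad places), with `hS`, `hS'`, `hunr` all holding.

So in p13's instance the binder families `(S) (hS) (hS') (hunr)` are DISCHARGED outright (at
`p = 3`: `obtain ⟨S, hS, hS', hunr⟩ := exists_finset_isUnramifiedOutside W 3 k`).  An hbd-free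
DIRECT proof of `𝓕_can,v ≤ H¹_ur` via `Hom_cont(I_v, T_pE)^{Frob = 1} = 0` (tame inertia) is not
needed and not attempted.

References: B. Howard, Compos. Math. 140 (2004) Def. 2.1.10 [Howard2004HeegnerKolyvagin];
B. Mazur, K. Rubin, Mem. AMS 799 (2004) Def. 2.1.1, Def. 3.2.1, Lemma 3.7.1; K. Rubin, PCMS 18
(2011) §3.1 [Rubin2011]; R. Sakamoto, JTNB 36 (2024) Def. 3.5–3.8, Thm. 4.4 [Sakamoto2024];
J. H. Silverman, *AEC* VII.4.1, VIII.§2, X.4.4 [SilvermanAEC2009]; J. S. Milne, *ADT* I.§2–§3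
[MilneADT2006].
-/

noncomputable section

open scoped Classical NumberField ContRepresentation
open Field NumberField IsDedekindDomain
open WeierstrassCurve Literature.NumberTheory.EllipticCurves Literature.NumberTheory.GaloisRepresentations
  Literature.NumberTheory.GaloisRepresentations.DiscreteGaloisModule

namespace Summit.BirchSwinnertonDyer.Rank1Residual.GaloisImage

variable (W : WeierstrassCurve ℚ) [W.IsElliptic] (p : ℕ) [hp : Fact p.Prime] (k : ℕ)

/-! ## §1. At a good `v ∤ p`: `𝓛_v(p^{k+1}) = H¹_ur(ℚ_v, E[p^{k+1}])` (x11b), hence `𝓕_can,v = H¹_ur` -/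

/-- **At a good finite `v ∤ p` the local Kummer condition of `E[p^{k+1}]` IS
`H¹_ur(ℚ_v, E[p^{k+1}])`**, in p13's level spelling `p^k · p`: the x11b theorem
`X11b.KummerPT.kummerSelmerStructure_inr_eq_unramifiedSubgroup W p (k+1)` (Silverman X.4.4 /
Milne I Prop. 3.8 at the completion; any number field, here `K = ℚ`) transported along
`((p ^ (k+1) : ℕ) : ℤ) = (p : ℤ) ^ k * p`.  Imported, not restated.
[cite: SilvermanAEC2009, Cor. X.4.4] [cite: MilneADT2006, Ch. I Prop. 3.8] -/
theorem kummerSelmerStructure_inr_eq_unramifiedSubgroup_pow_mul {v : HeightOneSpectrum (𝓞 ℚ)}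
    (hpv : ((p : ℕ) : 𝓞 ℚ) ∉ v.asIdeal) (hv : W.HasGoodReductionAt v) :
    W.kummerSelmerStructure ((p : ℤ) ^ k * (p : ℤ)) (Sum.inr v) =
      unramifiedSubgroup (GaloisRep.toLocal v (W.torsionGaloisModule ((p : ℤ) ^ k * (p : ℤ)))) 1 := by
  have h := X11b.KummerPT.kummerSelmerStructure_inr_eq_unramifiedSubgroup W p (k + 1) hpv hv
  have e : ((p ^ (k + 1) : ℕ) : ℤ) = (p : ℤ) ^ k * (p : ℤ) := by push_cast; ring
  rw [e] at h
  exact h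

/-- **`𝓕_can(E[p^{k+1}])_v = 𝓛_v(p^{k+1})` at EVERY finite place `v ∤ p`, unconditionally** (any
reduction type at `v`): the level-`k` Kummer sandwich
`propagatedSelmerStructure_eq_kummerSelmerStructure_of_bounded` of `PropagatedStructureKummerLevel.lean`
fed with the theorem `bounded_pPrimaryTorsion_localGaloisModule_rat` (`LocalH1TorsionBounded.lean`:
the `p`-power torsion of `H¹(ℚ_v, E)` has bounded exponent at `v ∤ p`, from the tree's prime-to-`p`
local Euler–Poincaré characteristic).  Level-one analogue: n1011-p06's (Lℓ)
`propagatedSelmerStructureOne_inr_eq_kummerSelmerStructure`, whose binder hbd the same theorem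
discharges.  [cite: Rubin2011, §3.1 (p. 29)] [cite: MilneADT2006, Ch. I, Cor. 3.4] -/
theorem propagatedSelmerStructure_inr_eq_kummerSelmerStructure {v : HeightOneSpectrum (𝓞 ℚ)}
    (hpv : ((p : ℕ) : 𝓞 ℚ) ∉ v.asIdeal) :
    propagatedSelmerStructure W p k (Sum.inr v) =
      W.kummerSelmerStructure ((p : ℤ) ^ k * (p : ℤ)) (Sum.inr v) :=
  propagatedSelmerStructure_eq_kummerSelmerStructure_of_bounded W p k (Sum.inr v)
    (bounded_pPrimaryTorsion_localGaloisModule_rat W p hpv)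

/-- **`𝓕_can(E[p^{k+1}])_v = H¹_ur(ℚ_v, E[p^{k+1}])` at every good finite `v ∤ p`, unconditionally**:
`propagatedSelmerStructure_inr_eq_kummerSelmerStructure` (`𝓕_can,v = 𝓛_v(p^{k+1})`) followed by
`kummerSelmerStructure_inr_eq_unramifiedSubgroup_pow_mul` (`𝓛_v = H¹_ur`, x11b).  This is
Mazur–Rubin's "`𝓕_can` is unramified at `v ∤ p` where `T` is unramified" for `T = T_pE` at a good
place. [cite: Rubin2011, §3.1 (p. 29)] [cite: SilvermanAEC2009, Cor. X.4.4] -/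
theorem propagatedSelmerStructure_inr_eq_unramifiedSubgroup {v : HeightOneSpectrum (𝓞 ℚ)}
    (hpv : ((p : ℕ) : 𝓞 ℚ) ∉ v.asIdeal) (hv : W.HasGoodReductionAt v) :
    propagatedSelmerStructure W p k (Sum.inr v) =
      unramifiedSubgroup (GaloisRep.toLocal v (W.torsionGaloisModule ((p : ℤ) ^ k * (p : ℤ)))) 1 := by
  rw [propagatedSelmerStructure_inr_eq_kummerSelmerStructure W p k hpv]
  exact kummerSelmerStructure_inr_eq_unramifiedSubgroup_pow_mul W p k hpv hv

/-! ## §2. `𝓕_can(E[p^{k+1}])` is `IsUnramifiedOutside S` for `S ⊇ ∞ ∪ {p} ∪ {bad}` — p13's `hunr`, `hS'` -/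

/-- **`𝓕_can(E[p^{k+1}])` is unramified outside every finite `S ⊇ ∞ ∪ {v ∣ p} ∪ {bad v}`**
(Howard Def. 2.1.10 / Mazur–Rubin Def. 2.1.1, the tree's `SelmerStructure.IsUnramifiedOutside`), with
NO further hypothesis: every finite place outside `S` is good and prime to `p`, and there
`𝓕_can,v = H¹_ur(ℚ_v, E[p^{k+1}])` (`propagatedSelmerStructure_inr_eq_unramifiedSubgroup`).  This IS
the binder `hunr` of n1011-p13's `kolyvaginSystems_freeRankOne_propagatedSelmerStructure` for every
admissible `S` (at `p = 3`: `hunr := propagatedSelmerStructure_isUnramifiedOutside W 3 k S hS hp hbad`).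
[cite: Howard2004HeegnerKolyvagin, Def. 2.1.10 (arXiv:1202.6340 p. 6)] [cite: Rubin2011, §3.1 (p. 29)] -/
theorem propagatedSelmerStructure_isUnramifiedOutside (S : Finset (Place ℚ))
    (hinf : ∀ w : InfinitePlace ℚ, (Sum.inl w : Place ℚ) ∈ S)
    (hpS : ∀ v : HeightOneSpectrum (𝓞 ℚ), ((p : ℕ) : 𝓞 ℚ) ∈ v.asIdeal → (Sum.inr v : Place ℚ) ∈ S)
    (hbad : ∀ v : HeightOneSpectrum (𝓞 ℚ), ¬ W.HasGoodReductionAt v → (Sum.inr v : Place ℚ) ∈ S) :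
    (propagatedSelmerStructure W p k).IsUnramifiedOutside S := by
  refine ⟨hinf, fun v hvS => ?_⟩
  have hpv : ((p : ℕ) : 𝓞 ℚ) ∉ v.asIdeal := fun h => hvS (hpS v h)
  have hgood : W.HasGoodReductionAt v := by
    by_contra h
    exact hvS (hbad v h)
  exact propagatedSelmerStructure_inr_eq_unramifiedSubgroup W p k hpv hgood

omit hp in
/-- **The companion binder `hS'`**: for `S ⊇ {v ∣ p} ∪ {bad v}`, every finite place `v ∉ S` is prime
to `p` and `E[p^{k+1}]` is unramified at `v` in the sense of the tree's `GaloisRep.IsUnramifiedAt`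
(every inertia group above `v` acts trivially; Silverman VII.4.1(a), tree
`smul_geomTorsion_eq_of_mem_inertia`).  At `p = 3` this is literally p13's `hS'`.
[cite: SilvermanAEC2009, Prop. VII.4.1(a)] -/
theorem not_mem_and_isUnramifiedAt_of_not_mem (S : Finset (Place ℚ))
    (hpS : ∀ v : HeightOneSpectrum (𝓞 ℚ), ((p : ℕ) : 𝓞 ℚ) ∈ v.asIdeal → (Sum.inr v : Place ℚ) ∈ S)
    (hbad : ∀ v : HeightOneSpectrum (𝓞 ℚ), ¬ W.HasGoodReductionAt v → (Sum.inr v : Place ℚ) ∈ S)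
    {v : HeightOneSpectrum (𝓞 ℚ)} (hvS : (Sum.inr v : Place ℚ) ∉ S) :
    ((p : ℕ) : 𝓞 ℚ) ∉ v.asIdeal ∧
      GaloisRep.IsUnramifiedAt v (W.torsionGaloisModule ((p : ℤ) ^ k * (p : ℤ))) := by
  have hpv : ((p : ℕ) : 𝓞 ℚ) ∉ v.asIdeal := fun h => hvS (hpS v h)
  have hgood : W.HasGoodReductionAt v := by
    by_contra h
    exact hvS (hbad v h)
  have hn : (((p : ℤ) ^ k * (p : ℤ) : ℤ) : 𝓞 ℚ) ∉ v.asIdeal := by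
    rw [← pow_succ, Int.cast_pow, Int.cast_natCast]
    exact fun h => hpv (v.isPrime.mem_of_pow_mem (k + 1) h)
  exact ⟨hpv, fun 𝔓 h𝔓 τ hτ => LinearMap.ext fun P =>
    W.smul_geomTorsion_eq_of_mem_inertia hgood hn h𝔓 hτ P⟩

/-- **An admissible finite `S` exists, with `hS`, `hS'`, `hunr` all holding** — no hypothesis: take
`S = ∞ ∪ {v ∣ p} ∪ {bad v}` (finite: x11b's `exists_exceptional_finset`, Silverman VIII.1.3) and apply
`propagatedSelmerStructure_isUnramifiedOutside` and `not_mem_and_isUnramifiedAt_of_not_mem`.  The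
three conclusions are p13's binders `hS`, `hS'`, `hunr` in his spelling (at `p = 3`:
`obtain ⟨S, hS, hS', hunr⟩ := exists_finset_isUnramifiedOutside W 3 k`).
[cite: Howard2004HeegnerKolyvagin, Def. 2.1.10 (arXiv:1202.6340 p. 6)] [cite: SilvermanAEC2009, Rem. VIII.1.3] -/
theorem exists_finset_isUnramifiedOutside :
    ∃ S : Finset (Place ℚ), (∀ w : InfinitePlace ℚ, (Sum.inl w : Place ℚ) ∈ S) ∧
      (∀ v : HeightOneSpectrum (𝓞 ℚ), (Sum.inr v : Place ℚ) ∉ S →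
        ((p : ℕ) : 𝓞 ℚ) ∉ v.asIdeal ∧
          GaloisRep.IsUnramifiedAt v (W.torsionGaloisModule ((p : ℤ) ^ k * (p : ℤ)))) ∧
      (propagatedSelmerStructure W p k).IsUnramifiedOutside S := by
  obtain ⟨S, -, hinf, hpS, hbad⟩ := X11b.KummerPT.exists_exceptional_finset W p (∅ : Finset (Place ℚ))
  exact ⟨S, hinf, fun v hvS => not_mem_and_isUnramifiedAt_of_not_mem W p k S hpS hbad hvS,
    propagatedSelmerStructure_isUnramifiedOutside W p k S hinf hpS hbad⟩

end Summit.BirchSwinnertonDyer.Rank1Residual.GaloisImage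

end
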